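import Mathlib
import HarnessLib
import Summits.Ventures.LatticeQCDFlow.Exactness.U1WilsonForceLipschitz
import Summits.Ventures.LatticeQCDFlow.Exactness.U1ExactForceWilson

/-!
# The engine's `u1_2d` HMC as run — exact-gradient half kick `p ← p − ½ε ∂(βS_W)/∂θ`, `n` drifts of size `ε` — converges to the Wilson measure from every start whenever `16(d−1)|β|·τ² ≤ 3`

HONEST FRAMING: exact (Metropolis-corrected) sampling algorithms for lattice gauge theory;
figures of merit are autocorrelation/cost numbers at stated couplings and volumes; no
continuum-physics claim.

Venture `LatticeQCDFlow` (cell pub-lqcd), topic `Exactness`, FANOUT row 9 (eng-latcore, the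
engine `latflow.core.u1_2d.U1Field2D.hmc_trajectory(β, τ, nstep)`: `p ∼ N(0,1)`,
`p −= ½ε·force`, `nstep ×` {`θ += ε p`; `p −= ε·force` (½ at the end)}, `force = ∂(βS_W)/∂θ`,
`ε = τ/nstep`).  NEW WORK of the cell: the last identification in the chain row 9 gen-17
(`U1MultiStepLeapfrogHMCErgodic.lean`: `n`-step leapfrog HMC on `U(1)^E` converges from every start
for any `K`-Lipschitz bounded increment with `4Kεn² ≤ 3`) → row 14 (`U1WilsonForceLipschitz.lean`,
landed an hour later: the increment `a·Z`, `Z` the leading-order Wilson-flow field, is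
`8(d−1)|a|`-Lipschitz, so the hypothesis reads `32(d−1)|a|εn² ≤ 3`) → here: by row 14's GEN-11
`u1ExactForceRoutine_eq_flowField` the engine's EXACT-GRADIENT half kick
`κ_f · ∂_p(βS_W(e^{ip}·V))|_{p=0}` with `κ_f = −ε/2` IS `a·Z` with `a = βε/2` (`L ≥ 2`), so the
engine's kernel AS RUN is covered, with the hypothesis in the engine's own parameters.  Nothing is
cited as a fact; `u1Rep` (the defining representation, `QuantumLattice/GaugeGroups`) is used by name.

* `u1LeapfrogHMCN_congr` — the kernel depends on the increment, not on its measurability proof;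
* `u1ExactHalfKick_eq_smul_flowField` (`L ≥ 2`) — the exact-gradient increment with drift
  coefficient `1` and kick coefficient `κ_f` is `(−βκ_f)·Z`; `measurable_u1ExactHalfKick`;
* **`wilson_u1ExactHalfKickHMCN_uniformlyErgodic`** / **`wilsonMeasure_unique_invariant_u1ExactHalfKickHMCN`**
  — torus `(ℤ/L)^d`, `L ≥ 2`, any real `β`, `ε > 0`, `κ > 0`, `n ≥ 1` with **`16(d−1)|β|(nε)² ≤ 3`**:
  the `n`-step leapfrog HMC kernel whose increment is the exact gradient half kick `−½ε ∂(βS_W)`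
  (Metropolis test on `βS_W + T_κ`) converges to `wilsonMeasure u1Rep β` geometrically in total
  variation from EVERY initial law, and that measure is its unique invariant probability law.
  (`d = 2`, `β = 1`: trajectory length `τ = nε ≤ 0.43`; `β = 4`: `τ ≤ 0.21`.)

NOT CLAIMED: longer trajectories (the engine's usual `τ ≈ 1` is NOT covered); `L = 1`; the kinetic
normalisation `κ = ½` of the engine is one admissible value of `κ > 0`, nothing depends on it; any
rate; floating point.
-/

noncomputable section

namespace Summit.Ventures.LatticeQCDFlow.Exactness

open MeasureTheory ProbabilityTheory ProbabilityTheory.Kernel Set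
open Literature.MathematicalPhysics.QuantumFieldTheory Literature.MathematicalPhysics.QuantumLattice
open scoped ENNReal NNReal

section HalfKick

variable {d L : ℕ}

/-- The `n`-step kernel depends on the increment `g` only, not on the proof of its measurability
(so an identity of increments transports every theorem about the kernel). -/
theorem u1LeapfrogHMCN_congr {ι : Type*} [Fintype ι] {ε κ : ℝ} {g₁ g₂ : (ι → Circle) → ι → ℝ}
    (h : g₁ = g₂) (hg₁ : Measurable g₁) (hg₂ : Measurable g₂) (S : (ι → Circle) → ℝ) (n : ℕ) :
    u1LeapfrogHMCN ε κ hg₁ S n = u1LeapfrogHMCN ε κ hg₂ S n := by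
  subst h
  rfl

variable [NeZero L]

/-- **The engine's exact-gradient half kick is `(−βκ_f)·Z`** (`L ≥ 2`; drift coefficient `1`, kick
coefficient `κ_f`; row 14's `u1ExactForceRoutine_eq_flowField` with `c = 1`). -/
theorem u1ExactHalfKick_eq_smul_flowField (hL : 2 ≤ L) (β κf : ℝ) :
    (fun V : GaugeConfig d L Circle => fun i : Edge d L => κf * fderiv ℝ (fun p : (Edge d L → ℝ) =>
        (fun W : GaugeConfig d L Circle => β * wilsonAction u1Rep W)
          ((fun i : Edge d L => Circle.exp (1 * p i)) * V)) 0 (Pi.single i 1)) =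
      fun (V : GaugeConfig d L Circle) (e : Edge d L) => -(β * 1 * κf) * ∑ ν ∈ Finset.univ.erase e.2,
        (((plaquetteHolonomy V (e.1 - Pi.single ν 1) e.2 ν : Circle) : ℂ).im -
          ((plaquetteHolonomy V e.1 e.2 ν : Circle) : ℂ).im) :=
  u1ExactForceRoutine_eq_flowField hL β 1 κf

/-- The exact-gradient half kick is measurable (`L ≥ 2`). -/
theorem measurable_u1ExactHalfKick (hL : 2 ≤ L) (β κf : ℝ) :
    Measurable (fun V : GaugeConfig d L Circle => fun i : Edge d L => κf * fderiv ℝ (fun p : (Edge d L → ℝ) =>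
        (fun W : GaugeConfig d L Circle => β * wilsonAction u1Rep W)
          ((fun i : Edge d L => Circle.exp (1 * p i)) * V)) 0 (Pi.single i 1)) := by
  rw [u1ExactHalfKick_eq_smul_flowField hL β κf]
  exact measurable_smul_u1FlowField (d := d) (L := L) (-(β * 1 * κf))

/-- `|−(β · 1 · (−ε/2))| = |β| ε / 2` for `ε > 0`. -/
theorem abs_halfKick_coeff (β : ℝ) {ε : ℝ} (hε : 0 < ε) : |(-(β * 1 * (-(ε / 2))))| = |β| * (ε / 2) := by
  rw [mul_one, mul_neg, neg_neg, abs_mul, abs_of_pos (half_pos hε)]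

/-- **THE ENGINE'S `u1_2d` HMC AS RUN CONVERGES TO THE WILSON MEASURE FROM EVERY START WHENEVER
`16(d−1)|β|(nε)² ≤ 3`.**  Torus `(ℤ/L)^d`, `L ≥ 2`, any real `β`; increment = the exact gradient
half kick `−½ε ∂(βS_W)/∂θ` (kick coefficient `κ_f = −ε/2`), `n ≥ 1` drifts of size `ε > 0`, Gaussian
momenta with any `κ > 0`, Metropolis test on `βS_W + T_κ`. -/
theorem wilson_u1ExactHalfKickHMCN_uniformlyErgodic (hL : 2 ≤ L) (β : ℝ) {ε κ : ℝ} (hε : 0 < ε)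
    (hκ : 0 < κ) {n : ℕ} (hn : 1 ≤ n)
    (hτ : 16 * ((d - 1 : ℕ) : ℝ) * |β| * ((n : ℝ) * ε) ^ 2 ≤ 3) :
    ∃ δ : ℝ, 0 < δ ∧ δ ≤ 1 ∧
      ∀ (μ₀ : Measure (GaugeConfig d L Circle)) [IsProbabilityMeasure μ₀]
        (t : ℕ) (A : Set (GaugeConfig d L Circle)),
        |((fun m : Measure (GaugeConfig d L Circle) =>
              m.bind (u1LeapfrogHMCN ε κ (measurable_u1ExactHalfKick (d := d) (L := L) hL β (-(ε / 2)))
                (fun U => β * wilsonAction u1Rep U) n))^[t] μ₀).real A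
            - (wilsonMeasure (d := d) (L := L) u1Rep β).real A| ≤ (1 - δ) ^ t := by
  rw [u1LeapfrogHMCN_congr (u1ExactHalfKick_eq_smul_flowField hL β (-(ε / 2)))
    (measurable_u1ExactHalfKick hL β (-(ε / 2))) (measurable_smul_u1FlowField (-(β * 1 * (-(ε / 2)))))]
  refine wilson_u1LeapfrogHMCN_flowField_uniformlyErgodic u1Rep continuous_u1Rep β _ hε hκ hn ?_
  rw [abs_halfKick_coeff β hε]
  nlinarith [hτ]

/-- **… and the Wilson measure is its unique invariant probability law.** -/
theorem wilsonMeasure_unique_invariant_u1ExactHalfKickHMCN (hL : 2 ≤ L) (β : ℝ) {ε κ : ℝ}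
    (hε : 0 < ε) (hκ : 0 < κ) {n : ℕ} (hn : 1 ≤ n)
    (hτ : 16 * ((d - 1 : ℕ) : ℝ) * |β| * ((n : ℝ) * ε) ^ 2 ≤ 3)
    {π' : Measure (GaugeConfig d L Circle)} [IsProbabilityMeasure π']
    (hπ' : Invariant (u1LeapfrogHMCN ε κ (measurable_u1ExactHalfKick (d := d) (L := L) hL β (-(ε / 2)))
      (fun U => β * wilsonAction u1Rep U) n) π') :
    π' = wilsonMeasure (d := d) (L := L) u1Rep β := by
  rw [u1LeapfrogHMCN_congr (u1ExactHalfKick_eq_smul_flowField hL β (-(ε / 2)))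
    (measurable_u1ExactHalfKick hL β (-(ε / 2))) (measurable_smul_u1FlowField (-(β * 1 * (-(ε / 2)))))] at hπ'
  refine wilsonMeasure_unique_invariant_u1LeapfrogHMCN_flowField u1Rep continuous_u1Rep β _ hε hκ hn ?_ hπ'
  rw [abs_halfKick_coeff β hε]
  nlinarith [hτ]

end HalfKick

end Summit.Ventures.LatticeQCDFlow.Exactness
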